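import Summits.AtomisticToContinuum.Crystallization.Theorems.FrustratedLawDichotomyStrainedPatchHomSlopeLJAffine2Kit
import Summits.AtomisticToContinuum.Crystallization.Theorems.FrustratedLawDichotomyStrainedPatchHomSlopePathThirdSharp

/-!
# The SHARP per-label third-order slope remainder along the AFFINE reference: kernel arrays `pdA`/`ndA`/`radA`/`rem3LJS` and the real per-label estimate
# (27623 `(H) HomFloor (1/625)`, hcp half; the «sharp per-label rem3» lever, critic rows 1368 (2) / 1408 (4); hand-1 g35 §3c, g36 R3(iii))

decomp-a2c hand-1 g37 (crux `AperiodicFrustratedLawGap`, stmt-AtomisticToContinuum-27623).  The second-order centred affine slope leaf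
(`…HomSlopeLJAffine2Kit` / `…Affine2Q`) bounds the per-label third-order remainder by `K₃,b‖d_b‖³/6` with ONE isotropic tube constant
`K₃ = |α″ρ²|↑ + 8|α′ρ|↑ + 12|α|↑` (`rem3LJ`, 67 % of `Gs` on the full `2⁻⁹` bulk cell).  Along the affine reference the displacement has the structure
`d_b,k = Σ_a M_b,k,a D_a + s_k` (`…Affine2Q`, `|D_a| ≤ w_a/SC`, `|s_k|·SC ≤ ubA_k`), so its RADIAL component `⟪p_b, d_b⟫` is certified separately
(`pdA`, cross-entry cancellation inside each coefficient `Σ_k p_k M_b,k,a`), and `…HomSlopePathThirdSharp.slopeForm_thirdOrder_sharp` replaces `K₃‖d‖³` by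
`K₃♯A³ + 3K₂♯(A‖d‖² + A²‖d‖) + 6K₁♯‖d‖³` with `A = min(‖d‖, (|⟪p,d⟫| + ‖d‖²)/a)` (float hand-1 g36 `aniso.py`: `A/‖d‖ = 0.56–0.70` on the first shell, the
per-label sum `×3.5–5.8` smaller).

* §1 kernel arrays: `pdA` (radial), `nd2A`/`ndA` (norm, through `mDb + ubA`), `radA`, `cubS`, `kSl3Snum`, `rem3Sb`, ★ `rem3LJS c w J Lc`;
* §2 real soundness of the arrays under the affine displacement structure: ★ `abs_inner_le_pdA`, `abs_MDv_le`, `abs_coord_le`, `norm_sq_le_nd2A`,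
  `norm_le_ndA`, and the scaled-product bookkeeping `mul_le_cdivS`;
* (sequel `…HomSlopeLJThirdSharp`: ★★★ `label_slope3S_LJ` — the per-label third-order estimate with the SHARP constant, `label_slope3S_LJ_of_ok`,
  `rem3LJS_sum_le`; then the `…Affine2Q.slopeLJA2Q_bound_of_check` twin with `rem3LJS` in place of `rem3LJ`).  Kernel definitions + soundness; 0 sorry;
standard axioms; no instances / notation / `#eval`.  `--supports stmt-AtomisticToContinuum-27623`.
-/

noncomputable section

namespace Summit.AtomisticToContinuum.Crystallization.Theorems.FrustratedLawDichotomyStrainedPatchHomSlopeLJAffine2KitS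

open scoped BigOperators RealInnerProductSpace
open Literature.Analysis.ValidatedNumerics.Numerics
open Summit.AtomisticToContinuum.Crystallization.Theorems.ChargedEnergyGapNegative (E3)
open Summit.AtomisticToContinuum.Crystallization.Theorems.FrustratedLawDichotomyStrainedPatchHomSplit (latPt hexFrame hcpShift)
open Summit.AtomisticToContinuum.Crystallization.Theorems.FrustratedLawDichotomyStrainedPatchHomEntryGramHcp (dot3 mem_dot3)
open Summit.AtomisticToContinuum.Crystallization.Theorems.FrustratedLawDichotomyStrainedPatchHomForceKit (phiFI)
open Summit.AtomisticToContinuum.Crystallization.Theorems.FrustratedLawDichotomyStrainedPatchHomConvexCurvature (inner_eq_sum3 norm_sq_eq_sum)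
open Summit.AtomisticToContinuum.Crystallization.Theorems.FrustratedLawDichotomyStrainedPatchHomCurvCentre (norm_sq_le_of_abs_le)
open Summit.AtomisticToContinuum.Crystallization.Theorems.FrustratedLawDichotomyStrainedPatchHomCurvCentreKit
open Summit.AtomisticToContinuum.Crystallization.Theorems.FrustratedLawDichotomyStrainedPatchHomCurvRegime3
open Summit.AtomisticToContinuum.Crystallization.Theorems.FrustratedLawDichotomyStrainedPatchHomCurvLeafL (dflt3)
open Summit.AtomisticToContinuum.Crystallization.Theorems.FrustratedLawDichotomyStrainedPatchHomCurvCoeff3 (ljTripleFI mem_ljTripleFI)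
open Summit.AtomisticToContinuum.Crystallization.Theorems.FrustratedLawDichotomyStrainedPatchHomCurvLJ
  (A0lj B0lj A1qlj a1qLJ ttLJ t0LJ Q0 ljLabelOK betaLJ_of_mem_phiFI)
open Summit.AtomisticToContinuum.Crystallization.Theorems.FrustratedLawDichotomyStrainedPatchHomSlopeLJAffine
open Summit.AtomisticToContinuum.Crystallization.Theorems.FrustratedLawDichotomyStrainedPatchHomSlopeLJAffine2Kit (MfiA Mre mem_MfiA mDb)
open Summit.AtomisticToContinuum.Crystallization.Theorems.FrustratedLawDichotomyStrainedPatchTaylorChord (segR segS)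
open Summit.AtomisticToContinuum.Crystallization.Theorems.FrustratedLawDichotomyStrainedPatchHomSlopePathThirdSharp
  (slopeForm_thirdOrder_sharp abs_segS_le_min)

/-! ## §1. Kernel arrays -/

/-- Sum of three intervals. -/
def sum3i (f : Fin 3 → FI) : FI := ((f 0).add (f 1)).add (f 2)

/-- ★ `sum3i` encloses the sum. [folklore] -/
theorem mem_sum3i {g : Fin 3 → ℝ} {f : Fin 3 → FI} (h : ∀ k, FI.mem (g k) (f k)) : FI.mem (∑ k : Fin 3, g k) (sum3i f) := by
  rw [Fin.sum_univ_three, sum3i]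
  exact FI.mem_add (FI.mem_add (h 0) (h 1)) (h 2)

/-- ★ Scaled bound `P_b` of the RADIAL part `|⟪p_b, d_b⟫|` along the affine reference: `⌈(Σ_a |Σ_k p_k M_b,k,a|↑·w_a + Σ_k |p_k|↑·ubA_k)/SC⌉`. -/
def pdA (c w : (Fin 3 × Fin 3) ⊕ Fin 3 → ℤ) (J : Fin 3 → Fin 3 × Fin 3 → ℤ) (b : Fin 3 → ℤ) : ℤ :=
  cdiv (∑ a : Fin 3 × Fin 3, (sum3i fun k => (cenVec c b k).mul (MfiA c J b k a)).absHi * w (Sum.inl a) +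
    ∑ k : Fin 3, (cenVec c b k).absHi * ubA J w k) SC

/-- Scaled bound of `‖d_b‖²` along the affine reference: `⌈Σ_k (mD_k + ubA_k)² / SC⌉`. -/
def nd2A (c w : (Fin 3 × Fin 3) ⊕ Fin 3 → ℤ) (J : Fin 3 → Fin 3 × Fin 3 → ℤ) (b : Fin 3 → ℤ) : ℤ :=
  cdiv (∑ k : Fin 3, (mDb c w J b k + ubA J w k) ^ 2) SC

/-- Scaled bound of `‖d_b‖` along the affine reference. -/
def ndA (c w : (Fin 3 × Fin 3) ⊕ Fin 3 → ℤ) (J : Fin 3 → Fin 3 × Fin 3 → ℤ) (b : Fin 3 → ℤ) : ℤ := (FI.sqrt ⟨0, nd2A c w J b⟩).hi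

/-- ★ Scaled RADIAL bound `A = min(N, ⌈(P + N2)·SC / tlo⌉)` (`N ≥ ‖d‖·SC`, `N2 ≥ ‖d‖²·SC`, `P ≥ |⟪p,d⟫|·SC`, `tlo` the scaled tube floor). -/
def radA (P N N2 tlo : ℤ) : ℤ := min N (cdiv ((P + N2) * SC) tlo)

/-- Scaled cube `⌈⌈A²/SC⌉·A/SC⌉`. -/
def cubS (A : ℤ) : ℤ := cdiv (cdiv (A * A) SC * A) SC

/-- ★ Scaled SHARP third-order numerator `(|α″ρ²|↑ + 2|α′ρ|↑)·A³ + 3(|α′ρ|↑ + |α|↑)(A·N2 + A²·N) + 6|α|↑·N·N2` (all products rescaled to `SC`). -/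
def kSl3Snum (tt : FI × FI × FI) (A N N2 : ℤ) : ℤ :=
  (tt.2.2.absHi + 2 * tt.2.1.absHi) * cubS A +
    3 * (tt.2.1.absHi + tt.1.absHi) * (cdiv (A * N2) SC + cdiv (cdiv (A * A) SC * N) SC) + 6 * tt.1.absHi * cdiv (N * N2) SC

/-- Scaled sharp third-order remainder of ONE label (tube data on the hull box, radial/norm data along the affine reference): `⌈num / (6 SC)⌉`. -/
def rem3Sb (c w : (Fin 3 × Fin 3) ⊕ Fin 3 → ℤ) (J : Fin 3 → Fin 3 × Fin 3 → ℤ) (b : Fin 3 → ℤ) : ℤ :=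
  cdiv (kSl3Snum ((ttLJ c (hullW J w) b).getD dflt3)
    (radA (pdA c w J b) (ndA c w J b) (nd2A c w J b) (tube2 c (hullW J w) b).lo) (ndA c w J b) (nd2A c w J b)) (6 * SC)

/-- ★ **THE SHARP scaled third-order remainder** `Σ_b rem3Sb` (replaces `rem3LJ c (hullW J w) Lc` of the second-order affine slope leaf). -/
def rem3LJS (c w : (Fin 3 × Fin 3) ⊕ Fin 3 → ℤ) (J : Fin 3 → Fin 3 × Fin 3 → ℤ) (Lc : List (Fin 3 → ℤ)) : ℤ := (Lc.map fun b => rem3Sb c w J b).sum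

/-! ## §2. Soundness of the arrays under the affine displacement structure -/

/-- Scaled products: `0 ≤ x ≤ X/SC`, `0 ≤ y ≤ Y/SC` ⟹ `x·y ≤ ⌈X·Y/SC⌉/SC`. [arithmetic] -/
theorem mul_le_cdivS {x y : ℝ} {X Y : ℤ} (hx0 : 0 ≤ x) (hy0 : 0 ≤ y) (hx : x ≤ (X : ℝ) / SC) (hy : y ≤ (Y : ℝ) / SC) :
    x * y ≤ ((cdiv (X * Y) SC : ℤ) : ℝ) / SC := by
  have hS : (0 : ℝ) < SC := by norm_num [SC]
  have h1 : x * y ≤ (X : ℝ) / SC * ((Y : ℝ) / SC) := mul_le_mul hx hy hy0 (hx0.trans hx)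
  have hcd := div_le_cdiv (a := X * Y) (b := (SC : ℤ)) (by norm_num [SC])
  push_cast at hcd
  calc x * y ≤ (X : ℝ) / SC * ((Y : ℝ) / SC) := h1
    _ = (X : ℝ) * Y / SC / SC := by field_simp
    _ ≤ ((cdiv (X * Y) SC : ℤ) : ℝ) / SC := div_le_div_of_nonneg_right hcd hS.le

/-- ★ **The radial bound**: `d_k = Σ_a M_b,k,a D_a + s_k`, `|D_a| ≤ w_a/SC`, `|s_k|·SC ≤ ubA_k` ⟹ `|⟪p_b, d⟫|·SC ≤ pdA`. [folklore: regroup by entry] -/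
theorem abs_inner_le_pdA {c w : (Fin 3 × Fin 3) ⊕ Fin 3 → ℤ} {J : Fin 3 → Fin 3 × Fin 3 → ℤ} {b : Fin 3 → ℤ} {Dv : Fin 3 × Fin 3 → ℝ}
    {s : Fin 3 → ℝ} {d : E3} (hdm : ∀ k, d k = (∑ a : Fin 3 × Fin 3, Mre c J b k a * Dv a) + s k)
    (hDv : ∀ a, |Dv a| ≤ (w (Sum.inl a) : ℝ) / SC) (hs : ∀ k, |s k| * SC ≤ (ubA J w k : ℝ)) :
    |⟪cenPt c b, d⟫| * SC ≤ (pdA c w J b : ℝ) := by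
  have hS : (0 : ℝ) < SC := by norm_num [SC]
  set p : E3 := cenPt c b with hp
  set C : Fin 3 × Fin 3 → ℝ := fun a => ∑ k : Fin 3, p k * Mre c J b k a with hC
  set Xa : Fin 3 × Fin 3 → ℤ := fun a => (sum3i fun k => (cenVec c b k).mul (MfiA c J b k a)).absHi with hXa
  have hsplit : ⟪p, d⟫ = ∑ a : Fin 3 × Fin 3, C a * Dv a + ∑ k : Fin 3, p k * s k := by
    rw [inner_eq_sum3]
    have e1 : ∑ k : Fin 3, p k * d k = ∑ k : Fin 3, (∑ a : Fin 3 × Fin 3, p k * (Mre c J b k a * Dv a)) + ∑ k : Fin 3, p k * s k := by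
      rw [← Finset.sum_add_distrib]
      exact Finset.sum_congr rfl fun k _ => by rw [hdm k, mul_add, Finset.mul_sum]
    rw [e1, Finset.sum_comm]
    congr 1
    exact Finset.sum_congr rfl fun a _ => by rw [hC]; simp only []; rw [Finset.sum_mul]; exact Finset.sum_congr rfl fun k _ => by ring
  have hcoef : ∀ a, |C a| * SC ≤ (Xa a : ℝ) := fun a =>
    FI.abs_le_absHi (mem_sum3i fun k => FI.mem_mul (mem_cenVec c b k) (mem_MfiA c J b k a))
  have hpk : ∀ k, |p k| * SC ≤ ((cenVec c b k).absHi : ℝ) := fun k => FI.abs_le_absHi (mem_cenVec c b k)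
  have hb1 : |∑ a : Fin 3 × Fin 3, C a * Dv a| ≤ ∑ a : Fin 3 × Fin 3, (Xa a : ℝ) / SC * ((w (Sum.inl a) : ℝ) / SC) := by
    refine (Finset.abs_sum_le_sum_abs _ _).trans (Finset.sum_le_sum fun a _ => ?_)
    rw [abs_mul]
    have h1 : |C a| ≤ (Xa a : ℝ) / SC := by rw [le_div_iff₀ hS]; exact hcoef a
    exact mul_le_mul h1 (hDv a) (abs_nonneg _) ((abs_nonneg _).trans h1)
  have hb2 : |∑ k : Fin 3, p k * s k| ≤ ∑ k : Fin 3, ((cenVec c b k).absHi : ℝ) / SC * ((ubA J w k : ℝ) / SC) := by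
    refine (Finset.abs_sum_le_sum_abs _ _).trans (Finset.sum_le_sum fun k _ => ?_)
    rw [abs_mul]
    have h1 : |p k| ≤ ((cenVec c b k).absHi : ℝ) / SC := by rw [le_div_iff₀ hS]; exact hpk k
    have h2 : |s k| ≤ (ubA J w k : ℝ) / SC := by rw [le_div_iff₀ hS]; exact hs k
    exact mul_le_mul h1 h2 (abs_nonneg _) ((abs_nonneg _).trans h1)
  have hsum : |⟪p, d⟫| ≤ (∑ a : Fin 3 × Fin 3, (Xa a : ℝ) / SC * ((w (Sum.inl a) : ℝ) / SC)) +
      ∑ k : Fin 3, ((cenVec c b k).absHi : ℝ) / SC * ((ubA J w k : ℝ) / SC) := by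
    rw [hsplit]; exact (abs_add_le _ _).trans (add_le_add hb1 hb2)
  have e : ((∑ a : Fin 3 × Fin 3, (Xa a : ℝ) / SC * ((w (Sum.inl a) : ℝ) / SC)) +
      ∑ k : Fin 3, ((cenVec c b k).absHi : ℝ) / SC * ((ubA J w k : ℝ) / SC)) * SC =
      ((∑ a : Fin 3 × Fin 3, Xa a * w (Sum.inl a) + ∑ k : Fin 3, (cenVec c b k).absHi * ubA J w k : ℤ) : ℝ) / SC := by
    push_cast
    rw [add_mul, Finset.sum_mul, Finset.sum_mul, add_div, Finset.sum_div, Finset.sum_div]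
    congr 1
    · exact Finset.sum_congr rfl fun a _ => by field_simp
    · exact Finset.sum_congr rfl fun k _ => by field_simp
  have hcd := div_le_cdiv (a := ∑ a : Fin 3 × Fin 3, Xa a * w (Sum.inl a) + ∑ k : Fin 3, (cenVec c b k).absHi * ubA J w k)
    (b := (SC : ℤ)) (by norm_num [SC])
  calc |⟪p, d⟫| * SC ≤ ((∑ a : Fin 3 × Fin 3, (Xa a : ℝ) / SC * ((w (Sum.inl a) : ℝ) / SC)) +
        ∑ k : Fin 3, ((cenVec c b k).absHi : ℝ) / SC * ((ubA J w k : ℝ) / SC)) * SC := mul_le_mul_of_nonneg_right hsum hS.le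
    _ = _ := e
    _ ≤ (pdA c w J b : ℝ) := by
        rw [pdA]
        push_cast at hcd ⊢
        exact hcd

/-- `|Σ_a M_b,k,a D_a|·SC ≤ mD_b,k`. [folklore; verbatim the in-proof step of `…Affine2Q`] -/
theorem abs_MDv_le {c w : (Fin 3 × Fin 3) ⊕ Fin 3 → ℤ} {J : Fin 3 → Fin 3 × Fin 3 → ℤ} {b : Fin 3 → ℤ} {Dv : Fin 3 × Fin 3 → ℝ}
    (hDv : ∀ a, |Dv a| ≤ (w (Sum.inl a) : ℝ) / SC) (k : Fin 3) :
    |∑ a : Fin 3 × Fin 3, Mre c J b k a * Dv a| * SC ≤ (mDb c w J b k : ℝ) := by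
  have hS : (0 : ℝ) < SC := by norm_num [SC]
  have h1 : |∑ a : Fin 3 × Fin 3, Mre c J b k a * Dv a| ≤ ∑ a : Fin 3 × Fin 3, ((MfiA c J b k a).absHi : ℝ) / SC * ((w (Sum.inl a) : ℝ) / SC) := by
    refine (Finset.abs_sum_le_sum_abs _ _).trans (Finset.sum_le_sum fun a _ => ?_)
    rw [abs_mul]
    have hA : |Mre c J b k a| ≤ ((MfiA c J b k a).absHi : ℝ) / SC := by rw [le_div_iff₀ hS]; exact FI.abs_le_absHi (mem_MfiA c J b k a)
    exact mul_le_mul hA (hDv a) (abs_nonneg _) ((abs_nonneg _).trans hA)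
  have hcd := div_le_cdiv (a := ∑ a : Fin 3 × Fin 3, (MfiA c J b k a).absHi * w (Sum.inl a)) (b := (SC : ℤ)) (by exact_mod_cast hS)
  have e : (∑ a : Fin 3 × Fin 3, ((MfiA c J b k a).absHi : ℝ) / SC * ((w (Sum.inl a) : ℝ) / SC)) * SC =
      ((∑ a : Fin 3 × Fin 3, (MfiA c J b k a).absHi * w (Sum.inl a) : ℤ) : ℝ) / (SC : ℤ) := by
    push_cast; rw [Finset.sum_mul, Finset.sum_div]; exact Finset.sum_congr rfl fun a _ => by field_simp
  calc |∑ a : Fin 3 × Fin 3, Mre c J b k a * Dv a| * SC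
      ≤ (∑ a : Fin 3 × Fin 3, ((MfiA c J b k a).absHi : ℝ) / SC * ((w (Sum.inl a) : ℝ) / SC)) * SC := mul_le_mul_of_nonneg_right h1 hS.le
    _ = _ := e
    _ ≤ (mDb c w J b k : ℝ) := by rw [mDb]; exact_mod_cast hcd

/-- `|d_k|·SC ≤ mD_k + ubA_k` along the affine reference. [folklore] -/
theorem abs_coord_le {c w : (Fin 3 × Fin 3) ⊕ Fin 3 → ℤ} {J : Fin 3 → Fin 3 × Fin 3 → ℤ} {b : Fin 3 → ℤ} {Dv : Fin 3 × Fin 3 → ℝ}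
    {s : Fin 3 → ℝ} {d : E3} (hdm : ∀ k, d k = (∑ a : Fin 3 × Fin 3, Mre c J b k a * Dv a) + s k)
    (hDv : ∀ a, |Dv a| ≤ (w (Sum.inl a) : ℝ) / SC) (hs : ∀ k, |s k| * SC ≤ (ubA J w k : ℝ)) (k : Fin 3) :
    |d k| * SC ≤ ((mDb c w J b k + ubA J w k : ℤ) : ℝ) := by
  rw [hdm k]
  push_cast
  calc |(∑ a : Fin 3 × Fin 3, Mre c J b k a * Dv a) + s k| * SC ≤ (|∑ a : Fin 3 × Fin 3, Mre c J b k a * Dv a| + |s k|) * SC :=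
        mul_le_mul_of_nonneg_right (abs_add_le _ _) (by norm_num [SC])
    _ = |∑ a : Fin 3 × Fin 3, Mre c J b k a * Dv a| * SC + |s k| * SC := by ring
    _ ≤ (mDb c w J b k : ℝ) + (ubA J w k : ℝ) := add_le_add (abs_MDv_le hDv k) (hs k)

/-- ★ `‖d_b‖²·SC ≤ nd2A` along the affine reference. [folklore] -/
theorem norm_sq_le_nd2A {c w : (Fin 3 × Fin 3) ⊕ Fin 3 → ℤ} {J : Fin 3 → Fin 3 × Fin 3 → ℤ} {b : Fin 3 → ℤ} {Dv : Fin 3 × Fin 3 → ℝ}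
    {s : Fin 3 → ℝ} {d : E3} (hdm : ∀ k, d k = (∑ a : Fin 3 × Fin 3, Mre c J b k a * Dv a) + s k)
    (hDv : ∀ a, |Dv a| ≤ (w (Sum.inl a) : ℝ) / SC) (hs : ∀ k, |s k| * SC ≤ (ubA J w k : ℝ)) :
    ‖d‖ ^ 2 * SC ≤ (nd2A c w J b : ℝ) := by
  have hS : (0 : ℝ) < SC := by norm_num [SC]
  have hk : ∀ k, |d k| ≤ ((mDb c w J b k + ubA J w k : ℤ) : ℝ) / SC := fun k => by
    rw [le_div_iff₀ hS]; exact abs_coord_le hdm hDv hs k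
  have h1 := norm_sq_le_of_abs_le d _ hk
  have h2 : (∑ k : Fin 3, (((mDb c w J b k + ubA J w k : ℤ) : ℝ) / SC) ^ 2) * SC = (∑ k : Fin 3, ((mDb c w J b k + ubA J w k : ℤ) : ℝ) ^ 2) / SC := by
    rw [Finset.sum_mul, Finset.sum_div]
    exact Finset.sum_congr rfl fun k _ => by field_simp
  have h3 : (∑ k : Fin 3, ((mDb c w J b k + ubA J w k : ℤ) : ℝ) ^ 2) / SC ≤ (nd2A c w J b : ℝ) := by
    have := div_le_cdiv (a := ∑ k : Fin 3, (mDb c w J b k + ubA J w k) ^ 2) (b := (SC : ℤ)) (by exact_mod_cast hS)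
    rw [nd2A]
    push_cast at this ⊢
    exact this
  calc ‖d‖ ^ 2 * SC ≤ (∑ k : Fin 3, (((mDb c w J b k + ubA J w k : ℤ) : ℝ) / SC) ^ 2) * SC := mul_le_mul_of_nonneg_right h1 hS.le
    _ = _ := h2
    _ ≤ _ := h3

/-- ★ `‖d_b‖·SC ≤ ndA` along the affine reference. [folklore] -/
theorem norm_le_ndA {c w : (Fin 3 × Fin 3) ⊕ Fin 3 → ℤ} {J : Fin 3 → Fin 3 × Fin 3 → ℤ} {b : Fin 3 → ℤ} {Dv : Fin 3 × Fin 3 → ℝ}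
    {s : Fin 3 → ℝ} {d : E3} (hdm : ∀ k, d k = (∑ a : Fin 3 × Fin 3, Mre c J b k a * Dv a) + s k)
    (hDv : ∀ a, |Dv a| ≤ (w (Sum.inl a) : ℝ) / SC) (hs : ∀ k, |s k| * SC ≤ (ubA J w k : ℝ)) :
    ‖d‖ * SC ≤ (ndA c w J b : ℝ) := by
  have hmem : FI.mem (‖d‖ ^ 2) ⟨0, nd2A c w J b⟩ := by
    refine ⟨?_, ?_⟩
    · push_cast; positivity
    · exact norm_sq_le_nd2A hdm hDv hs
  have h := FI.mem_sqrt hmem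
  rw [Real.sqrt_sq (norm_nonneg _)] at h
  exact h.2

end Summit.AtomisticToContinuum.Crystallization.Theorems.FrustratedLawDichotomyStrainedPatchHomSlopeLJAffine2KitS

end
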